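import Summits.ABC.IUTFork.Joshi.ATS4Eq6811ThetaTower
import HarnessLib

/-!
# [J-IV] (arXiv:2403.10430v2) §6.8 (6.8.11) at the genuine theta tower — THREE-WAY form of the `V^dst_ℚ` hypothesis
# (Lemma 6.7.1 (2) OR (3)): `Supp(q_{L_tpd})` is admitted into `V^dst_ℚ` WITHOUT a ramification statement at the bad primes

Proof-only sequel (0 defs) of `Joshi/ATS4Eq6811ThetaTower.lean` (abc-iut-E-t33 gen 5, p454744; R-J «JOSHI Y-DISCHARGE CENSUS» rows
Y-21f / Y-21e, rung LADDER-ABC:A2.RESCUE.J). SOURCE: K. Joshi, *Construction of Arithmetic Teichmüller Spaces IV*, arXiv:2403.10430v2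
(unrefereed; bib `Joshi2024ATS4`): Lemma 6.7.1 p.61 l.24–30 «(1) v_ℚ ∈ V^dst_ℚ. (2) v_ℚ ramifies in L′. (3) v_ℚ divides 30·ℓ or v_ℚ is
in the image of Supp(q_{L_tpd} + d_{L_tpd})»; (6.8.11)–(6.8.12) p.64 l.2–13; the component-sum bookkeeping (6.11.2) p.70 l.4–29 (E-t31's
`LocusVolumeDatum.ComponentSums`: «log(q) is the sum of its v_ℚ-components over V^dst_ℚ», which needs `Supp(q) ⊆ V^dst`, i.e.
characterization (3)). [IUTchIV] Thm. 1.10 proof Step (iii) p.25–26, (D2)/(D6) (kurims pages). Page/line = the cell's render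
`HOME/lit/renders/Joshi-arxiv-2403.10430/`.

WHY. p454744's `sum_log_vdst_le_thetaTower` takes `V^dst_ℚ` by characterization (2) («ramifies in L′»). A supplier who fills the slot by
characterization (3) — so that `Supp(q_{L_tpd}) ⊆ V^dst` holds by construction and the `q`-half of `ComponentSums` is available — would
owe Joshi's (3) ⟹ (2), which at a prime of multiplicative reduction `∤ 2·3·5·ℓ` unramified in `L_tpd` is a Tate-curve ramification
statement (`ℓ ∤ ord_v(q_v)`, i.e. Lemma 5.8.7 (2) = [IUTchIV] (P2)). The tree's Step (iii) for REAL fields does not need it: abc-iut-L5-t15's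
three-way `sum_log_distinguished_le_tower'` admits «`q` under a BAD place of `F_mod`» directly ((D2)). THIS FILE transports that form:

* `sum_log_vdst_le_thetaTower'` — as p454744's theorem, for every finite set `V` of primes each of which divides `2·3·5·ℓ`, OR lies under a
  bad place of `λ` away from `{2, ℓ}` (`Supp(q_{L_tpd})`, the tree's `Cor22.badPlacesAvoid P {2,ℓ}`), OR ramifies in `K = L′`:
  `Σ_{p ∈ V} log p ≤ 2·[ℚ(j(λ)):ℚ]·(log-diff(λ) + log f^{∤{2,ℓ}}(λ)) + log(2·3·5·ℓ)`. (A prime under `Supp(d_{L_tpd})` ramifies in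
  `L_tpd ⊆ L′`, so (3)'s other half is already inside (2).)
* `LocusVolumeDatum.eq6811_of_thetaTowerGlue'` — `dd.Eq6811` for every carrier glued to the genuine theta datum with the three-way
  `V^dst_ℚ` slot and `log(s_ℚ) = Σ_{p ∈ V^dst_ℚ} log p`, `[L_mod:ℚ] ≥ [ℚ(j(λ)):ℚ]`.
* `abc_of_descentInputs_exists_genuineVdst'` — p447878's ∃-form E5 spine with `Eq6811` REMOVED, the supplier's `V^dst_ℚ` slot in the
  three-way form (so it may contain `Supp(q_{L_tpd})` outright): EIGHT named inputs + glue ⟹ `ABC`, implication only.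

FRAMING (binding): NO side is taken on [IUTchIII] Cor. 3.12 / [IUTchIV] Thm. 1.10, on Joshi's claims, or on Mochizuki's report on them;
NOT an abc claim; typed ≠ proved ≠ endorsed. Classical algebraic number theory + bookkeeping; theorems only; standard axioms; no `sorry`,
instance, notation, `def` or new `Prop` fact. [claim: Joshi2024ATS4, status: disputed]; [claim: Mochizuki2012, status: disputed].
-/

noncomputable section

namespace Summit.ABC.IUTFork.Joshi.ATS4

open Literature.NumberTheory.DiophantineGeometry Literature.NumberTheory.DiophantineGeometry.GenEll
open Literature.NumberTheory.EllipticCurves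
open Literature.IUT.LogVolume Literature.IUT.LogVolume.Cor22
open NumberField IsDedekindDomain
open scoped Classical

section ThetaTower

variable {P : NFPoint} {F : Type} [Field F] [NumberField F] [Algebra P.F F]
  {K : Type} [Field K] [NumberField K] [Algebra F K] [Algebra P.F K] [IsScalarTower P.F F K]
  (ψ : K →ₐ[F] AlgebraicClosure F) {ℓ : ℕ}

/-- **(6.8.11) at the genuine theta tower, `V^dst_ℚ` in the THREE-WAY form** (Lemma 6.7.1 (2) ∨ (3), p.61 l.24–30; [IUTchIV] Step
(iii) (D2)/(D6) p.25–26). For `λ ∈ U_X` minimally presented, `ℓ` prime, `F` a theta field, `K ⊇ F` Galois inside `F(E_F[ℓ])` (via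
`ψ`), and any finite set `V` of primes each of which divides `2·3·5·ℓ`, OR is the residue characteristic of a bad place of `λ` away
from `{2, ℓ}` (`Supp(q_{L_tpd})`), OR ramifies in `K`:
`Σ_{p ∈ V} log p ≤ 2·[ℚ(j(λ)):ℚ]·(log-diff(λ) + log f^{∤{2,ℓ}}(λ)) + log(2·3·5·ℓ)`. abc-iut-L5-t15's `sum_log_distinguished_le_tower'`
over `F_mod = ℚ(j(λ)) ⊆ F_tpd` (Galois, `Cor22.isGalois_adjoin_jInv`) with (D0) ⟹ (D5) = p454744's `thetaTower_ramified_descends`.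
PROVED; no hypothesis beyond the binders. [cite: Mochizuki2012, IUTchIV Thm 1.10 proof Step (iii) p.26] -/
theorem sum_log_vdst_le_thetaTower' (hP : P ∈ UP) (hF : IsThetaField P F) [IsGalois F K] (hℓ : ℓ.Prime)
    (hK : letI := thetaCurve_isElliptic hP.1 F
      ((thetaCurve P F).galoisRepTorsion (ℓ : ℤ)).ker ≤ ψ.fieldRange.fixingSubgroup)
    (V : Finset ℕ) (hV : ∀ q ∈ V, q.Prime)
    (hVK : ∀ q ∈ V, q ∣ 2 * 3 * 5 * ℓ ∨ (∃ v ∈ badPlacesAvoid P {2, ℓ}, residueChar P.F v = q) ∨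
      ∃ u : HeightOneSpectrum (𝓞 K), residueChar K u = q ∧ 2 ≤ u.asIdeal.ramificationIdx ℤ) :
    ∑ q ∈ V, Real.log q ≤
      2 * (dmod P : ℝ) * (P.logDiff + logCondAvoid P {2, ℓ}) + Real.log (2 * 3 * 5 * (ℓ : ℝ)) := by
  -- the Galois layer `F_mod = ℚ(j(λ)) ⊆ F_tpd`
  set Fmod := IntermediateField.adjoin ℚ ({jInv P.x} : Set P.F) with hFmod
  haveI : NumberField Fmod := NumberField.mk
  haveI : IsGalois Fmod P.F := isGalois_adjoin_jInv P hP
  -- bad places of `F_tpd` away from `{2, ℓ}` and their images in `F_mod`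
  set T₀ := badPlacesAvoid P {2, ℓ} with hT₀
  set S := T₀.image (finBelow Fmod P.F) with hS
  have hT : ∀ w, w ∈ T₀ ↔ finBelow Fmod P.F w ∈ S := by
    intro w
    refine ⟨fun hw => Finset.mem_image_of_mem _ hw, fun hw => ?_⟩
    obtain ⟨w', hw', hww'⟩ := Finset.mem_image.mp hw
    exact mem_badPlacesAvoid_of_finBelow_eq P {2, ℓ} hww'.symm hw'
  -- the right-hand side in the tower lemma's currency
  have hrhs : 2 * (Module.finrank ℚ Fmod : ℝ) *
      (ndeg P.F (differentDivisor P.F) + ndeg P.F (ADivisor.reduced T₀)) + Real.log (2 * 3 * 5 * (ℓ : ℝ)) =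
      2 * (dmod P : ℝ) * (P.logDiff + logCondAvoid P {2, ℓ}) + Real.log (2 * 3 * 5 * (ℓ : ℝ)) := by
    rw [logDiff_add_logCondAvoid_eq_ndeg]
    rfl
  rw [← hrhs]
  refine sum_log_distinguished_le_tower' P.F K Fmod S T₀ hT hℓ.pos V hV (fun q hq => ?_)
    fun u hram hndvd => thetaTower_ramified_descends ψ hP.1 hF hℓ hK u hram hndvd
  rcases hVK q hq with h | ⟨v, hv, hvq⟩ | h
  · exact Or.inl h
  · refine Or.inr (Or.inl ⟨finBelow Fmod P.F v, Finset.mem_image_of_mem _ hv, ?_⟩)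
    rw [residueChar_finBelow, hvq]
  · exact Or.inr (Or.inr h)

variable (Lmod : Type*) [Field Lmod] [NumberField Lmod] (h5 : 5 ≤ ℓ)
  (hq : 0 < (TateDivisorDatum.ofNFPointOver P {2, ℓ} F).logq)

/-- **Y-21f, three-way form: `Eq6811` HOLDS for every carrier glued to the genuine theta datum whose `V^dst_ℚ` slot consists of primes
dividing `2·3·5·ℓ`, or under `Supp(q_{L_tpd})` away from `{2,ℓ}`, or ramified in `K = L′`, and whose `log(s_ℚ)` slot is `Σ_{p ∈ V^dst_ℚ}
log p`** (`[L_mod:ℚ] ≥ [ℚ(j(λ)):ℚ]`). PROVED; FACT rows: none. [claim: Joshi2024ATS4, status: disputed] -/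
theorem LocusVolumeDatum.eq6811_of_thetaTowerGlue' (hP : P ∈ UP) (hF : IsThetaField P F) [IsGalois F K] (hℓ : ℓ.Prime)
    (hK : letI := thetaCurve_isElliptic hP.1 F
      ((thetaCurve P F).galoisRepTorsion (ℓ : ℤ)).ker ≤ ψ.fieldRange.fixingSubgroup)
    {dd : LocusVolumeDatum}
    (G : MainBoundGlue (MainBoundDatum.ofGenuine Lmod hℓ h5 (TateDivisorDatum.ofNFPoint P {2, ℓ})
      (TateDivisorDatum.ofNFPointOver P {2, ℓ} F) (TateDivisorDatum.ofNFPointOver P {2, ℓ} K) hq) dd)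
    (hmod : Cor22.dmod P ≤ dMod Lmod) (hV : ∀ q ∈ dd.Vdst, q.Prime)
    (hVK : ∀ q ∈ dd.Vdst, q ∣ 2 * 3 * 5 * ℓ ∨ (∃ v ∈ badPlacesAvoid P {2, ℓ}, residueChar P.F v = q) ∨
      ∃ u : HeightOneSpectrum (𝓞 K), residueChar K u = q ∧ 2 ≤ u.asIdeal.ramificationIdx ℤ)
    (hsQ : dd.logsQ = ∑ q ∈ dd.Vdst, Real.log q) : dd.Eq6811 := by
  unfold LocusVolumeDatum.Eq6811
  have hsum := sum_log_vdst_le_thetaTower' ψ hP hF hℓ hK dd.Vdst hV hVK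
  have hT : dd.logDiffTpd + dd.logCondTpd = P.logDiff + logCondAvoid P {2, ℓ} := by
    rw [G.logDiffTpd_eq, G.logCondTpd_eq]
    exact MainBoundDatum.thetaTower_logDiffCond_eq Lmod hℓ h5 hq
  have hTnn : 0 ≤ P.logDiff + logCondAvoid P {2, ℓ} := by
    rw [← hT]; exact add_nonneg dd.logDiffTpd_nonneg dd.logCondTpd_nonneg
  have hdm : (Cor22.dmod P : ℝ) ≤ (dd.dmod : ℝ) := by
    rw [G.dmod_eq]; exact_mod_cast hmod
  have hl : (dd.l : ℝ) = (ℓ : ℝ) := by rw [G.l_eq]; rfl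
  rw [hsQ, hT, hl]
  have hmono : 2 * (Cor22.dmod P : ℝ) * (P.logDiff + logCondAvoid P {2, ℓ}) ≤
      2 * (dd.dmod : ℝ) * (P.logDiff + logCondAvoid P {2, ℓ}) :=
    mul_le_mul_of_nonneg_right (by linarith) hTnn
  linarith

end ThetaTower

/-- **p447878's ∃-form E5 spine with `Eq6811` REMOVED — three-way `V^dst_ℚ` slot.** As p454744's `abc_of_descentInputs_exists_genuineVdst`,
but the supplier's `V^dst_ℚ` may contain, besides primes dividing `2·3·5·ℓ` and primes ramified in its `K = L′`, the residue characteristics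
of `Supp(q_{L_tpd})` away from `{2, ℓ}` OUTRIGHT (Lemma 6.7.1 (3)) — so `Supp(q) ⊆ V^dst`, which the `q`-half of `ComponentSums` reads, costs
no ramification statement. EIGHT named inputs ((6.11.1), Prop. 6.10.9 on `V^dst_ℚ`, the component sums, Lemma 6.7.8, the LOWER BOUND =
[J-III] Cor. 9.11.1.1 at `φ(y₀)`, the two Frobenius-shift equalities, «(1/2ℓ) log q = |log q_ℓ|») + glue + `[ℚ(j(λ)):ℚ] ≤ [L_mod:ℚ] ≤ d`
⟹ `ABC`. PROVED AS AN IMPLICATION; NO abc claim; no side taken. [claim: Joshi2024ATS4, status: disputed] -/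
theorem abc_of_descentInputs_exists_genuineVdst'
    (h : ∀ (d : ℕ), 0 < d → ∀ P ∈ UPle d, ∀ (ℓ : ℕ) (hℓ : ℓ.Prime) (h5 : 5 ≤ ℓ), IsLem587Prime d P ℓ → ITDConditions P ℓ →
      AdmitsCore P →
        ∃ (F : Type) (_ : Field F) (_ : NumberField F) (_ : Algebra P.F F)
          (K : Type) (_ : Field K) (_ : NumberField K) (_ : Algebra F K) (_ : Algebra P.F K) (_ : IsScalarTower P.F F K)
          (_ : IsGalois F K) (ψ : K →ₐ[F] AlgebraicClosure F) (hU : P.InU) (_ : IsThetaField P F)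
          (_ : letI := thetaCurve_isElliptic hU F
            ((thetaCurve P F).galoisRepTorsion (ℓ : ℤ)).ker ≤ ψ.fieldRange.fixingSubgroup)
          (hq : 0 < (TateDivisorDatum.ofNFPointOver P {2, ℓ} F).logq)
          (Lmod : Type) (_ : Field Lmod) (_ : NumberField Lmod) (_ : Cor22.dmod P ≤ dMod Lmod) (dd : LocusVolumeDatum),
          MainBoundGlue (MainBoundDatum.ofGenuine Lmod hℓ h5 (TateDivisorDatum.ofNFPoint P {2, ℓ})
            (TateDivisorDatum.ofNFPointOver P {2, ℓ} F) (TateDivisorDatum.ofNFPointOver P {2, ℓ} K) hq) dd ∧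
          ((∀ q ∈ dd.Vdst, q.Prime ∧ (q ∣ 2 * 3 * 5 * ℓ ∨ (∃ v ∈ badPlacesAvoid P {2, ℓ}, residueChar P.F v = q) ∨
              ∃ u : HeightOneSpectrum (𝓞 K), residueChar K u = q ∧ 2 ≤ u.asIdeal.ramificationIdx ℤ)) ∧
            dd.logsQ = ∑ q ∈ dd.Vdst, Real.log q) ∧
          (dd.Eq6111 ∧ (∀ p ∈ dd.Vdst, dd.Prop6109 p) ∧ dd.ComponentSums ∧ dd.Lem678 ∧ dd.LowerBound ∧
            dd.FrobShiftQ ∧ dd.FrobShiftVol ∧ dd.LogqDictionary) ∧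
          dMod Lmod ≤ d) : ABC := by
  refine abc_of_descentInputs_exists fun d hd P hP ℓ hℓ h5 hℓP hITD hcore => ?_
  obtain ⟨F, _, _, _, K, _, _, _, _, _, _, ψ, hU, hF, hK, hq, Lmod, _, _, hmod, dd, G, ⟨hV, hsQ⟩,
    ⟨h₁, h₂, h₃, h₆, h₇, h₈, h₉, hDic⟩, hdmod⟩ := h d hd P hP ℓ hℓ h5 hℓP hITD hcore
  have h₅ : dd.Eq6811 :=
    LocusVolumeDatum.eq6811_of_thetaTowerGlue' ψ Lmod h5 hq hP.1 hF hℓ hK G hmod (fun q hq' => (hV q hq').1)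
      (fun q hq' => (hV q hq').2) hsQ
  exact ⟨F, inferInstance, inferInstance, inferInstance, K, inferInstance, inferInstance, inferInstance, inferInstance,
    inferInstance, inferInstance, ψ, hU, hF, hK, hq, Lmod, inferInstance, inferInstance, dd, G,
    ⟨h₁, h₂, h₃, h₅, h₆, h₇, h₈, h₉, hDic⟩, hdmod⟩

/-- **The bad primes are inside the three-way `V^dst_ℚ` by construction**: for the genuine Tate-divisor datum `ofNFPoint λ {2,ℓ}`
(`Supp(q_{L_tpd})` = the tree's `badPlacesAvoid λ {2,ℓ}`, E-t30's `TateDivisorDatum.ofNFPoint_V_eq`), every residue characteristic of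
`Supp(q_{L_tpd})` satisfies the middle disjunct — the inclusion «Supp(q) ⊆ V^dst» that the `q`-half of `ComponentSums` presupposes
(Lemma 6.7.1 (3) ⟹ (1)). PROVED (definitional). [claim: Joshi2024ATS4, status: disputed] -/
theorem residueChar_supp_mem_threeWay (P : NFPoint) (ℓ : ℕ) (K : Type) [Field K] [NumberField K]
    (v : HeightOneSpectrum (𝓞 P.F)) (hv : v ∈ (TateDivisorDatum.ofNFPoint P {2, ℓ}).V) :
    residueChar P.F v ∣ 2 * 3 * 5 * ℓ ∨ (∃ w ∈ badPlacesAvoid P {2, ℓ}, residueChar P.F w = residueChar P.F v) ∨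
      ∃ u : HeightOneSpectrum (𝓞 K), residueChar K u = residueChar P.F v ∧ 2 ≤ u.asIdeal.ramificationIdx ℤ := by
  rw [TateDivisorDatum.ofNFPoint_V_eq] at hv
  exact Or.inr (Or.inl ⟨v, hv, rfl⟩)

end Summit.ABC.IUTFork.Joshi.ATS4

end
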